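import Literature.NumberTheory.LFunctions.HalaszPartialSummation
import HarnessLib

/-!
# Granville–Soundararajan 2003, Lemma 2.1 for multiplicative functions

`Literature.NumberTheory.LFunctions.Halasz.exists_norm_S_mul_log_le_integral`
(`HalaszPartialSummation.lean`) proves Granville–Soundararajan's Lemma 2.1, (2.1),
`|S(x)| log x ≤ x ∫_{log 2}^{log x} |S(e^u)| e^{-u} du + C x` (`S(y) = ∑_{n ≤ y} g(n)`), for
COMPLETELY multiplicative `1`-bounded `g`, where the first step
`∑_{n ≤ y} g(n) log n = ∑_{d ≤ y} Λ(d) g(d) S(y/d)` is an identity.  This file proves the same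
estimate for MULTIPLICATIVE `1`-bounded `f` (the generality of Theorem 1 of the paper), following
the printed proof: for `d = p^k`,
`∑_{m ≤ y/p^k} f(m p^k) = f(p^k) S(y/p^k) + O(#{m ≤ y/p^k : p ∣ m}) = f(p^k) S(y/p^k) + O(y/p^{k+1})`,
and `∑_{p^k ≤ y} log p · y/p^{k+1} = O(y)`, whence (2.3)
`S(y) log y = ∑_{d ≤ y} f(d) Λ(d) S(y/d) + O(y)`; the Abel summation against the prime number
theorem ((2.4) ⟹ (2.1)) is then imported verbatim from `HalaszPartialSummation.lean`, whose
lemmas from that point on only use `|f| ≤ 1`.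

## Main results
- `norm_sum_mul_log_sub_le` : (2.3) in the form
  `‖∑_{n ≤ y} f(n) log n − ∑_{d ≤ y} Λ(d) f(d) S(y/d)‖ ≤ 2y ∑_{d ≤ y} Λ(d)/(d · minFac d)`;
- `exists_sum_vonMangoldt_div_mul_minFac_le` : `∑_{d ≤ Y} Λ(d)/(d · minFac d) ≤ C₀` (absolute);
- `exists_norm_S_mul_log_le` : (2.4), `‖S(y)‖ log y ≤ ∑_{d ≤ y} Λ(d) ‖S(y/d)‖ + C₁ y`;
- `exists_norm_S_mul_log_le_integral` : **Lemma 2.1, (2.1)** for multiplicative `f`.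

## References
- [GranvilleSoundararajan2003] A. Granville, K. Soundararajan, *Decay of mean values of
  multiplicative functions*, Canad. J. Math. 55 (2003), 1191–1230, Lemma 2.1 and its proof
  ((2.3)–(2.4)), arXiv math/9911246 p. 4.

## Design choices
* `f : ℕ → ℂ` with `∀ m n, Coprime m n → f (m n) = f m f n` and `‖f‖ ≤ 1` (no `f 1 = 1` needed);
  sums are over `Finset.Icc 1 ⌊y⌋₊` as in `Halasz.S`; logarithmic scale `u = log y` as in the tree.
* Constants are existential (absolute); no definitions are introduced.
-/

noncomputable section

open Finset Real Complex MeasureTheory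
open scoped ArithmeticFunction.vonMangoldt

namespace Literature.NumberTheory.LFunctions

namespace GranvilleSoundararajan

open Halasz (S normSExp)

variable {f : ℕ → ℂ}

/-! ### (2.3): the local error at a prime power -/

/-- `#{1 ≤ m ≤ M : p ∣ m} = ⌊M/p⌋`. [folklore] -/
theorem card_Icc_filter_dvd (M p : ℕ) : #{m ∈ Icc 1 M | p ∣ m} = M / p := by
  rw [show Icc 1 M = Ioc 0 M by ext m; simp only [mem_Icc, mem_Ioc]; omega]
  exact Nat.Ioc_filter_dvd_card_eq_div M p

/-- For a prime power `d = p^k` and multiplicative `1`-bounded `f`: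
`‖∑_{m ≤ M} f(d m) − f(d) ∑_{m ≤ M} f(m)‖ ≤ 2 ⌊M/p⌋` (only the `m` divisible by `p` contribute,
each at most `2`). [cite: GranvilleSoundararajan2003, proof of Lemma 2.1 (display before (2.3))] -/
theorem norm_sum_primePow_mul_sub_le (hf : ∀ m n, Nat.Coprime m n → f (m * n) = f m * f n)
    (hfb : ∀ n, ‖f n‖ ≤ 1) {d : ℕ} (hd : IsPrimePow d) (M : ℕ) :
    ‖∑ m ∈ Icc 1 M, f (d * m) - f d * ∑ m ∈ Icc 1 M, f m‖ ≤ 2 * ((M / d.minFac : ℕ) : ℝ) := by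
  set p := d.minFac with hp_def
  have hp : p.Prime := Nat.minFac_prime hd.ne_one
  have hdp : p ^ (d.factorization p) = d := hd.minFac_pow_factorization_eq
  rw [Finset.mul_sum, ← Finset.sum_sub_distrib]
  have hvan : ∀ m ∈ Icc 1 M, ¬ p ∣ m → f (d * m) - f d * f m = 0 := by
    intro m _ hpm
    have hcop : d.Coprime m := by
      rw [← hdp]; exact Nat.Coprime.pow_left _ (hp.coprime_iff_not_dvd.mpr hpm)
    rw [hf d m hcop, sub_self]
  rw [← Finset.sum_filter_add_sum_filter_not (Icc 1 M) (fun m => p ∣ m),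
    Finset.sum_eq_zero (s := (Icc 1 M).filter (fun m => ¬ p ∣ m)) (fun m hm => by
      rw [mem_filter] at hm; exact hvan m hm.1 hm.2), add_zero]
  calc ‖∑ m ∈ (Icc 1 M).filter (fun m => p ∣ m), (f (d * m) - f d * f m)‖
      ≤ ∑ m ∈ (Icc 1 M).filter (fun m => p ∣ m), ‖f (d * m) - f d * f m‖ := norm_sum_le _ _
    _ ≤ ∑ m ∈ (Icc 1 M).filter (fun m => p ∣ m), (2 : ℝ) := by
        refine Finset.sum_le_sum fun m _ => ?_
        calc ‖f (d * m) - f d * f m‖ ≤ ‖f (d * m)‖ + ‖f d * f m‖ := norm_sub_le _ _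
          _ ≤ 1 + 1 := by
              refine add_le_add (hfb _) ?_
              rw [norm_mul]
              exact mul_le_one₀ (hfb d) (norm_nonneg _) (hfb m)
          _ = 2 := by norm_num
    _ = 2 * ((M / p : ℕ) : ℝ) := by
        rw [Finset.sum_const, nsmul_eq_mul, card_Icc_filter_dvd, mul_comm]

/-- **(2.3) for multiplicative `f`**: with `S(z) = ∑_{n ≤ z} f(n)` and `Y = ⌊y⌋`,
`‖∑_{n ≤ y} f(n) log n − ∑_{d ≤ y} Λ(d) f(d) S(y/d)‖ ≤ 2y ∑_{d ≤ Y} Λ(d)/(d · minFac d)`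
(for `d = p^k` the local error is `≤ 2⌊⌊y/d⌋/p⌋ ≤ 2y/p^{k+1}`).
[cite: GranvilleSoundararajan2003, Lemma 2.1, (2.3)] -/
theorem norm_sum_mul_log_sub_le (hf : ∀ m n, Nat.Coprime m n → f (m * n) = f m * f n)
    (hfb : ∀ n, ‖f n‖ ≤ 1) {y : ℝ} (hy : 0 ≤ y) :
    ‖∑ n ∈ Icc 1 ⌊y⌋₊, f n * (Real.log n : ℂ) -
        ∑ d ∈ Icc 1 ⌊y⌋₊, (Λ d : ℂ) * f d * S f (y / d)‖ ≤
      2 * y * ∑ d ∈ Icc 1 ⌊y⌋₊, Λ d / ((d : ℝ) * d.minFac) := by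
  set Y := ⌊y⌋₊ with hY
  have h1 : ∑ n ∈ Icc 1 Y, f n * (Real.log n : ℂ) =
      ∑ d ∈ Icc 1 Y, (Λ d : ℂ) * ∑ m ∈ Icc 1 (Y / d), f (d * m) := by
    have h1' : ∀ n ∈ Icc 1 Y, f n * (Real.log n : ℂ) = ∑ d ∈ n.divisors, (Λ d : ℂ) * f n := by
      intro n _
      rw [← Finset.sum_mul, ← Complex.ofReal_sum, ArithmeticFunction.vonMangoldt_sum, mul_comm]
    rw [Finset.sum_congr rfl h1', Halasz.sum_Icc_sum_divisors_eq (fun d n => (Λ d : ℂ) * f n)]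
    refine Finset.sum_congr rfl fun d _ => ?_
    rw [Finset.mul_sum]
  have h2 : ∀ d ∈ Icc 1 Y, S f (y / d) = ∑ m ∈ Icc 1 (Y / d), f m := by
    intro d _
    unfold S
    rw [Nat.floor_div_natCast]
  rw [h1, ← Finset.sum_sub_distrib, Finset.mul_sum]
  refine (norm_sum_le _ _).trans (Finset.sum_le_sum fun d hd => ?_)
  have hd' := hd
  rw [Finset.mem_Icc] at hd'
  have hd0 : (0 : ℝ) < d := by exact_mod_cast hd'.1
  rw [h2 d hd, mul_assoc, ← mul_sub, norm_mul, Complex.norm_real,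
    Real.norm_of_nonneg ArithmeticFunction.vonMangoldt_nonneg]
  have hmf0 : (0 : ℝ) < d.minFac := by exact_mod_cast (Nat.minFac_pos d)
  by_cases hpp : IsPrimePow d
  · have hloc : ‖∑ m ∈ Icc 1 (Y / d), f (d * m) - f d * ∑ m ∈ Icc 1 (Y / d), f m‖ ≤
        2 * (y / ((d : ℝ) * d.minFac)) := by
      refine (norm_sum_primePow_mul_sub_le hf hfb hpp (Y / d)).trans ?_
      refine mul_le_mul_of_nonneg_left ?_ (by norm_num)
      calc (((Y / d) / d.minFac : ℕ) : ℝ) ≤ ((Y / d : ℕ) : ℝ) / d.minFac := Nat.cast_div_le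
        _ ≤ ((Y : ℝ) / d) / d.minFac := by gcongr; exact Nat.cast_div_le
        _ ≤ (y / d) / d.minFac := by gcongr; exact Nat.floor_le hy
        _ = y / ((d : ℝ) * d.minFac) := by rw [div_div]
    calc Λ d * ‖∑ m ∈ Icc 1 (Y / d), f (d * m) - f d * ∑ m ∈ Icc 1 (Y / d), f m‖
        ≤ Λ d * (2 * (y / ((d : ℝ) * d.minFac))) :=
          mul_le_mul_of_nonneg_left hloc ArithmeticFunction.vonMangoldt_nonneg
      _ = 2 * y * (Λ d / ((d : ℝ) * d.minFac)) := by ring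
  · have h0 : Λ d = 0 := ArithmeticFunction.vonMangoldt_eq_zero_iff.mpr hpp
    rw [h0]
    simp

/-- **The error weights sum to `O(1)`**: there is an absolute `C₀ ≥ 0` with
`∑_{d ≤ Y} Λ(d)/(d · minFac d) ≤ C₀` for all `Y`, i.e. `∑_{p^k} log p/p^{k+1} < ∞`
(here `C₀ = 4 ∑_n n^{-3/2}`, via `∑_k p^{-k-1} ≤ 2/p²` and `log p ≤ 2√p`).
[cite: GranvilleSoundararajan2003, proof of Lemma 2.1 ("it follows that … + O(x)")] -/
theorem exists_sum_vonMangoldt_div_mul_minFac_le :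
    ∃ C₀ : ℝ, 0 ≤ C₀ ∧ ∀ Y : ℕ, ∑ d ∈ Icc 1 Y, Λ d / ((d : ℝ) * d.minFac) ≤ C₀ := by
  have hsum : Summable (fun n : ℕ => ((n : ℝ) ^ (3 / 2 : ℝ))⁻¹) :=
    Real.summable_nat_rpow_inv.mpr (by norm_num)
  have hterm0 : ∀ n : ℕ, 0 ≤ ((n : ℝ) ^ (3 / 2 : ℝ))⁻¹ := fun n => by positivity
  refine ⟨4 * ∑' n : ℕ, ((n : ℝ) ^ (3 / 2 : ℝ))⁻¹, by positivity, fun Y => ?_⟩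
  -- restrict to prime powers
  set s := (Icc 1 Y).filter IsPrimePow with hs
  have hres : ∑ d ∈ Icc 1 Y, Λ d / ((d : ℝ) * d.minFac) = ∑ d ∈ s, Λ d / ((d : ℝ) * d.minFac) := by
    rw [hs, Finset.sum_filter_of_ne]
    intro d _ hne
    by_contra hnot
    rw [ArithmeticFunction.vonMangoldt_eq_zero_iff.mpr hnot, zero_div] at hne
    exact hne rfl
  rw [hres]
  -- the injection `d ↦ (minFac d, v_{minFac d}(d))`
  set e : ℕ → ℕ × ℕ := fun d => (d.minFac, d.factorization d.minFac) with he
  set G : ℕ × ℕ → ℝ := fun q => if q.1.Prime then Real.log q.1 / (q.1 : ℝ) ^ (q.2 + 1) else 0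
    with hG
  have hG0 : ∀ q, 0 ≤ G q := by
    intro q
    simp only [hG]
    split_ifs with hq
    · have : (1 : ℝ) ≤ q.1 := by exact_mod_cast hq.one_lt.le
      exact div_nonneg (Real.log_nonneg this) (by positivity)
    · exact le_rfl
  have hval : ∀ d ∈ s, Λ d / ((d : ℝ) * d.minFac) = G (e d) := by
    intro d hd
    rw [hs, Finset.mem_filter] at hd
    have hpp := hd.2
    have hp : d.minFac.Prime := Nat.minFac_prime hpp.ne_one
    have hdp : d.minFac ^ (d.factorization d.minFac) = d := hpp.minFac_pow_factorization_eq
    simp only [hG, he, if_pos hp]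
    rw [ArithmeticFunction.vonMangoldt_apply, if_pos hpp]
    have hd_eq : (d : ℝ) = (d.minFac : ℝ) ^ (d.factorization d.minFac) := by exact_mod_cast hdp.symm
    rw [hd_eq, ← pow_succ]
  have hinj : Set.InjOn e s := by
    intro d₁ hd₁ d₂ hd₂ heq
    have h1 := (Finset.mem_filter.mp hd₁).2.minFac_pow_factorization_eq
    have h2 := (Finset.mem_filter.mp hd₂).2.minFac_pow_factorization_eq
    simp only [he, Prod.mk.injEq] at heq
    calc d₁ = d₁.minFac ^ d₁.factorization d₁.minFac := h1.symm
      _ = d₂.minFac ^ d₂.factorization d₂.minFac := by rw [heq.2, heq.1]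
      _ = d₂ := h2
  have hmaps : ∀ d ∈ s, e d ∈ Icc 1 Y ×ˢ Icc 1 Y := by
    intro d hd
    rw [hs, Finset.mem_filter, Finset.mem_Icc] at hd
    obtain ⟨⟨hd1, hdY⟩, hpp⟩ := hd
    have hp : d.minFac.Prime := Nat.minFac_prime hpp.ne_one
    simp only [he, Finset.mem_product, Finset.mem_Icc]
    refine ⟨⟨hp.one_lt.le, (Nat.minFac_le (by omega)).trans hdY⟩, ?_, ?_⟩
    · rcases Nat.eq_zero_or_pos (d.factorization d.minFac) with h0 | h0
      · have := hpp.minFac_pow_factorization_eq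
        rw [h0, pow_zero] at this
        exact absurd this.symm hpp.ne_one
      · exact h0
    · exact ((Nat.factorization_lt d.minFac (by omega)).le).trans hdY
  calc ∑ d ∈ s, Λ d / ((d : ℝ) * d.minFac) = ∑ d ∈ s, G (e d) := Finset.sum_congr rfl hval
    _ = ∑ q ∈ s.image e, G q := (Finset.sum_image hinj).symm
    _ ≤ ∑ q ∈ Icc 1 Y ×ˢ Icc 1 Y, G q :=
        Finset.sum_le_sum_of_subset_of_nonneg (Finset.image_subset_iff.mpr hmaps)
          (fun q _ _ => hG0 q)
    _ = ∑ p ∈ Icc 1 Y, ∑ k ∈ Icc 1 Y, G (p, k) := Finset.sum_product _ _ _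
    _ ≤ ∑ p ∈ Icc 1 Y, 4 * ((p : ℝ) ^ (3 / 2 : ℝ))⁻¹ := by
        refine Finset.sum_le_sum fun p hp => ?_
        by_cases hpr : p.Prime
        · have hp2 : (2 : ℝ) ≤ p := by exact_mod_cast hpr.two_le
          have hp0 : (0 : ℝ) < p := by linarith
          set r : ℝ := (p : ℝ)⁻¹ with hr
          have hr0 : 0 ≤ r := by positivity
          have hr12 : r ≤ 1 / 2 := by
            rw [hr, inv_le_comm₀ hp0 (by norm_num)]; norm_num; exact hpr.two_le
          have hr1 : r < 1 := by linarith
          have hGpk : ∀ k : ℕ, G (p, k) = Real.log p * r ^ (k + 1) := by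
            intro k
            simp only [hG, if_pos hpr, hr]
            rw [inv_pow, div_eq_mul_inv]
          -- reindex `Icc 1 Y` as `Ico 1 (Y+1)` and shift
          have hshift : ∑ k ∈ Icc 1 Y, G (p, k) = Real.log p * r ^ 2 * ∑ j ∈ Finset.range Y, r ^ j := by
            rw [show Icc 1 Y = Ico 1 (Y + 1) by ext k; simp only [mem_Icc, mem_Ico]; omega,
              Finset.sum_Ico_eq_sum_range, show Y + 1 - 1 = Y by omega, Finset.mul_sum]
            refine Finset.sum_congr rfl fun j _ => ?_
            rw [hGpk, show 1 + j + 1 = 2 + j by ring, pow_add]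
            ring
          have hgeom : ∑ j ∈ Finset.range Y, r ^ j ≤ 2 := by
            calc ∑ j ∈ Finset.range Y, r ^ j ≤ ∑' j : ℕ, r ^ j :=
                  (summable_geometric_of_lt_one hr0 hr1).sum_le_tsum _ (fun j _ => by positivity)
              _ = (1 - r)⁻¹ := tsum_geometric_of_lt_one hr0 hr1
              _ ≤ 2 := by rw [inv_le_comm₀ (by linarith) (by norm_num)]; linarith
          have hlogp : Real.log p ≤ 2 * (p : ℝ) ^ (1 / 2 : ℝ) := by
            have := Real.log_le_rpow_div hp0.le (by norm_num : (0 : ℝ) < 1 / 2)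
            linarith [this]
          have hlog0 : 0 ≤ Real.log p := Real.log_nonneg (by linarith)
          rw [hshift]
          calc Real.log p * r ^ 2 * ∑ j ∈ Finset.range Y, r ^ j
              ≤ Real.log p * r ^ 2 * 2 := by gcongr
            _ ≤ 2 * (p : ℝ) ^ (1 / 2 : ℝ) * r ^ 2 * 2 := by gcongr
            _ = 4 * ((p : ℝ) ^ (3 / 2 : ℝ))⁻¹ := by
                have h1 : ((p : ℝ)⁻¹) ^ 2 = (p : ℝ) ^ (-2 : ℝ) := by
                  rw [inv_pow, ← Real.rpow_natCast, ← Real.rpow_neg hp0.le]; norm_num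
                have h2 : ((p : ℝ) ^ (3 / 2 : ℝ))⁻¹ = (p : ℝ) ^ (-(3 / 2) : ℝ) := by
                  rw [Real.rpow_neg hp0.le]
                rw [hr, h1, h2, show (-(3 / 2) : ℝ) = 1 / 2 + (-2) by norm_num, Real.rpow_add hp0]
                ring
        · have : ∑ k ∈ Icc 1 Y, G (p, k) = 0 :=
            Finset.sum_eq_zero fun k _ => by simp only [hG, if_neg hpr]
          rw [this]
          exact mul_nonneg (by norm_num) (hterm0 p)
    _ = 4 * ∑ p ∈ Icc 1 Y, ((p : ℝ) ^ (3 / 2 : ℝ))⁻¹ := by rw [Finset.mul_sum]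
    _ ≤ 4 * ∑' n : ℕ, ((n : ℝ) ^ (3 / 2 : ℝ))⁻¹ := by
        gcongr
        exact hsum.sum_le_tsum _ (fun n _ => hterm0 n)

/-! ### (2.4) for multiplicative `f` and Lemma 2.1 -/

/-- **(2.4) for multiplicative `f`**: there is an absolute `C₁` such that for every multiplicative
`1`-bounded `f` and `y ≥ 1`, `‖S(y)‖ log y ≤ ∑_{d ≤ y} Λ(d) ‖S(y/d)‖ + C₁ y`
(from (2.3) and `∑_{n ≤ y} log(y/n) ≤ y`). [cite: GranvilleSoundararajan2003, Lemma 2.1, (2.4)] -/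
theorem exists_norm_S_mul_log_le :
    ∃ C₁ : ℝ, 0 ≤ C₁ ∧ ∀ f : ℕ → ℂ, (∀ m n, Nat.Coprime m n → f (m * n) = f m * f n) →
      (∀ n, ‖f n‖ ≤ 1) → ∀ y : ℝ, 1 ≤ y →
        ‖S f y‖ * Real.log y ≤ ∑ d ∈ Icc 1 ⌊y⌋₊, Λ d * ‖S f (y / d)‖ + C₁ * y := by
  obtain ⟨C₀, hC₀, hE⟩ := exists_sum_vonMangoldt_div_mul_minFac_le
  refine ⟨1 + 2 * C₀, by positivity, fun f hf hfb y hy => ?_⟩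
  have hy0 : 0 < y := by linarith
  have hdec : S f y * (Real.log y : ℂ) = ∑ n ∈ Icc 1 ⌊y⌋₊, f n * (Real.log n : ℂ) +
      ∑ n ∈ Icc 1 ⌊y⌋₊, f n * (Real.log (y / n) : ℂ) := by
    unfold S
    rw [Finset.sum_mul, ← Finset.sum_add_distrib]
    refine Finset.sum_congr rfl fun n hn => ?_
    rw [Finset.mem_Icc] at hn
    have hn0 : (0 : ℝ) < n := by exact_mod_cast hn.1
    rw [← mul_add, ← Complex.ofReal_add, Real.log_div hy0.ne' hn0.ne']
    ring_nf
  have hnorm : ‖S f y‖ * Real.log y = ‖S f y * (Real.log y : ℂ)‖ := by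
    rw [norm_mul, Complex.norm_real, Real.norm_of_nonneg (Real.log_nonneg hy)]
  rw [hnorm, hdec]
  refine (norm_add_le _ _).trans ?_
  -- the main sum, via (2.3)
  have hA : ‖∑ n ∈ Icc 1 ⌊y⌋₊, f n * (Real.log n : ℂ)‖ ≤
      ∑ d ∈ Icc 1 ⌊y⌋₊, Λ d * ‖S f (y / d)‖ + 2 * C₀ * y := by
    have h23 := norm_sum_mul_log_sub_le hf hfb hy0.le
    have hmain : ‖∑ d ∈ Icc 1 ⌊y⌋₊, (Λ d : ℂ) * f d * S f (y / d)‖ ≤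
        ∑ d ∈ Icc 1 ⌊y⌋₊, Λ d * ‖S f (y / d)‖ := by
      refine (norm_sum_le _ _).trans (Finset.sum_le_sum fun d _ => ?_)
      rw [norm_mul, norm_mul, Complex.norm_real, Real.norm_of_nonneg ArithmeticFunction.vonMangoldt_nonneg]
      calc Λ d * ‖f d‖ * ‖S f (y / d)‖ ≤ Λ d * 1 * ‖S f (y / d)‖ :=
            mul_le_mul_of_nonneg_right (mul_le_mul_of_nonneg_left (hfb d) ArithmeticFunction.vonMangoldt_nonneg)
              (norm_nonneg _)
        _ = Λ d * ‖S f (y / d)‖ := by ring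
    have herr : 2 * y * ∑ d ∈ Icc 1 ⌊y⌋₊, Λ d / ((d : ℝ) * d.minFac) ≤ 2 * C₀ * y := by
      calc 2 * y * ∑ d ∈ Icc 1 ⌊y⌋₊, Λ d / ((d : ℝ) * d.minFac) ≤ 2 * y * C₀ := by
            gcongr; exact hE _
        _ = 2 * C₀ * y := by ring
    have htri := norm_le_norm_add_norm_sub' (∑ n ∈ Icc 1 ⌊y⌋₊, f n * (Real.log n : ℂ))
      (∑ d ∈ Icc 1 ⌊y⌋₊, (Λ d : ℂ) * f d * S f (y / d))
    linarith
  -- the `log(y/n)` sum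
  have hB : ‖∑ n ∈ Icc 1 ⌊y⌋₊, f n * (Real.log (y / n) : ℂ)‖ ≤ y := by
    refine (norm_sum_le _ _).trans ?_
    refine le_trans (Finset.sum_le_sum fun n hn => ?_) (Halasz.sum_log_div_le hy)
    rw [Finset.mem_Icc] at hn
    have hn0 : (0 : ℝ) < n := by exact_mod_cast hn.1
    have hlog : 0 ≤ Real.log (y / n) := Real.log_nonneg (by
      rw [le_div_iff₀ hn0, one_mul]; exact le_trans (by exact_mod_cast hn.2) (Nat.floor_le hy0.le))
    rw [norm_mul, Complex.norm_real, Real.norm_of_nonneg hlog]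
    exact mul_le_of_le_one_left hlog (hfb n)
  calc ‖∑ n ∈ Icc 1 ⌊y⌋₊, f n * (Real.log n : ℂ)‖ + ‖∑ n ∈ Icc 1 ⌊y⌋₊, f n * (Real.log (y / n) : ℂ)‖
      ≤ (∑ d ∈ Icc 1 ⌊y⌋₊, Λ d * ‖S f (y / d)‖ + 2 * C₀ * y) + y := add_le_add hA hB
    _ = ∑ d ∈ Icc 1 ⌊y⌋₊, Λ d * ‖S f (y / d)‖ + (1 + 2 * C₀) * y := by ring

/-- **Granville–Soundararajan 2003, Lemma 2.1, (2.1), for multiplicative `f`** (logarithmic scale):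
there is an absolute `C` such that for every multiplicative `f : ℕ → ℂ` with `|f| ≤ 1` and every
`x ≥ 3`, `‖S(x)‖ log x ≤ x ∫_{log 2}^{log x} ‖S(e^u)‖ e^{-u} du + C x`, i.e.
`|S(x)| ≤ (x/log x) ∫_2^x |S(y)| y^{-2} dy + O(x/log x)`.  The Abel summation against the prime
number theorem is `Halasz.sum_vonMangoldt_mul_le`, `Halasz.exists_sum_abs_psi_sub_mul_kk_le` and
`Halasz.sum_norm_S_div_le` of the tree (they only use `|f| ≤ 1`).
[cite: GranvilleSoundararajan2003, Lemma 2.1, (2.1)] -/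
theorem exists_norm_S_mul_log_le_integral :
    ∃ C : ℝ, ∀ f : ℕ → ℂ, (∀ m n, Nat.Coprime m n → f (m * n) = f m * f n) → (∀ n, ‖f n‖ ≤ 1) →
      ∀ x : ℝ, 3 ≤ x →
        ‖S f x‖ * Real.log x ≤ x * (∫ u in Real.log 2..Real.log x, normSExp f u) + C * x := by
  obtain ⟨C, hC⟩ := Halasz.exists_sum_abs_psi_sub_mul_kk_le
  obtain ⟨C₁, hC₁, h24⟩ := exists_norm_S_mul_log_le
  refine ⟨C + 3 + C₁, fun f hf hfb x hx => ?_⟩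
  have hx1 : 1 ≤ x := by linarith
  have hx0 : 0 < x := by linarith
  have h1 := h24 f hf hfb x hx1
  have h2 := Halasz.sum_vonMangoldt_mul_le (g := f) hfb hx1
  have h3 := hC x hx
  have h4 := Halasz.sum_norm_S_div_le (g := f) hfb hx1
  have hYx : (⌊x⌋₊ : ℝ) ≤ x := Nat.floor_le hx0.le
  have hsplit : ∫ u in (0:ℝ)..Real.log x, normSExp f u =
      (∫ u in (0:ℝ)..Real.log 2, normSExp f u) + ∫ u in Real.log 2..Real.log x, normSExp f u :=
    (intervalIntegral.integral_add_adjacent_intervals (Halasz.intervalIntegrable_normSExp hfb _ _)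
      (Halasz.intervalIntegrable_normSExp hfb _ _)).symm
  have hsmall := Halasz.integral_normSExp_small_le (g := f) hfb
  rw [hsplit] at h4
  have h5 : x * ∫ u in (0:ℝ)..Real.log 2, normSExp f u ≤ x := by
    calc x * ∫ u in (0:ℝ)..Real.log 2, normSExp f u ≤ x * 1 := mul_le_mul_of_nonneg_left hsmall hx0.le
      _ = x := mul_one x
  nlinarith

end GranvilleSoundararajan

end Literature.NumberTheory.LFunctions
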